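import Mathlib
import Summits.Ventures.PercRepro2.TypedPocketOA2Support
import Summits.Ventures.PercRepro2.TypedPocketOA2CertB
import Summits.Ventures.PercRepro2.TypedPocketA1BTheorem

/-!
# The `{o, a₂}`-pocket class (HARRIS-2), IV: row 2′TRI on the class (blind cell PercRepro2, p3 g8,
2026-08-26; `proofs/P3-HARRIS.md` §6)

The `b`-pocket on the doors `o, a₂`, by the mechanism of the `{a₁, b}`-pocket
(`TypedPocketA1BTheorem.lean`): on a `SplitQ` the kernel `K₃` is a side kernel (`K3_eq_sideQ`), its
doubly symmetrised form is `dsymQ` on the side states (`symB_symA_sideΦQ`), `dsymQ` is the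
certified combination of six-fold symmetrised typed-Harris-with-spectator slacks at the SORTED far
triple plus a pointwise nonnegative remainder (`TypedPocketOA2CertB.lean`), the combination
factorises over the two sides, each slack has nonnegative typed count
(`TypedHarris.typedCount_slack_nonneg`) — so **every typed base of `K₃` is nonnegative**:
`typedCount_nonneg_of_splitQ`, the `z ≡ false` class `HasPocketOA2`,
`typedCount_nonneg_of_hasPocketOA2` and the root mirror `typedCount_nonneg_of_hasPocketOA2_mirror`
(the doors `o, a₁`).  Own work; standard axioms.
-/

namespace Summit.Ventures.PercRepro2

open UnionCluster

namespace CovForm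

namespace PocketOA2

open OneTyped TypedA3 Untouched TypedFactor Separated RootBridge SepThree PocketA1B

/-! ## The certified combination as a sum over generator labels -/

section Gensum

/-- The total weight of a generator label at a far triple. -/
def weightQ (g : GenLabel) (u v r : BSt) : ℕ :=
  (((certQ u v r).filter fun c => labelOf c = g).map fun c => c.2.2.2).sum

/-- **The certified combination is a sum over generator labels** with nonnegative integer
weights. -/
lemma combQ_eq_gensum (x y w : OSt) (u v r : BSt) :
    combQ x y w u v r =
      ∑ g : GenLabel, (weightQ g u v r : ℤ) * genQ g.1 g.2.1 g.2.2 x y w := by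
  unfold combQ weightQ
  exact listSum_eq_gensum (certQ u v r) (fun g => genQ g.1 g.2.1 g.2.2 x y w)

end Gensum

/-! ## The side kernel and its decomposition -/

section Main

open Classical

variable {V : Type*} {E : Type*} [Fintype E] [DecidableEq E] {R : Type*} [Field R]
  [LinearOrder R] [IsStrictOrderedRing R]
variable (ends : E → Sym2 V) (o a₁ a₂ a₃ b : V)

/-- The kernel on the side restrictions: `KB` on the glued side states. -/
noncomputable def sideΦQ (WP WF : Set V) :
    Config E → Config E → Config E → Config E → Config E → Config E → R :=
  fun xa ya wa xb yb wb =>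
    ((KB (gluedQ (PocketAB.oStP ends b o a₂ WP xa) (bSt ends a₁ a₂ a₃ o WF xb))
      (gluedQ (PocketAB.oStP ends b o a₂ WP ya) (bSt ends a₁ a₂ a₃ o WF yb))
      (gluedQ (PocketAB.oStP ends b o a₂ WP wa) (bSt ends a₁ a₂ a₃ o WF wb)) : ℤ) : R)

/-- The sorted far triple of three configurations. -/
noncomputable def sortedF (WF : Set V) (xb yb wb : Config E) : BSt × BSt × BSt :=
  sort3B (bSt ends a₁ a₂ a₃ o WF xb) (bSt ends a₁ a₂ a₃ o WF yb) (bSt ends a₁ a₂ a₃ o WF wb)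

/-- The certified part of the side kernel: the combination of slacks at the sorted far triple. -/
noncomputable def certΦQ (WP WF : Set V) :
    Config E → Config E → Config E → Config E → Config E → Config E → R :=
  fun xa ya wa xb yb wb =>
    ((combQ (PocketAB.oStP ends b o a₂ WP xa) (PocketAB.oStP ends b o a₂ WP ya)
      (PocketAB.oStP ends b o a₂ WP wa) (sortedF ends o a₁ a₂ a₃ WF xb yb wb).1
      (sortedF ends o a₁ a₂ a₃ WF xb yb wb).2.1 (sortedF ends o a₁ a₂ a₃ WF xb yb wb).2.2 : ℤ) : R)

variable {ends o a₁ a₂ a₃ b}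

omit [Fintype E] [LinearOrder R] [IsStrictOrderedRing R] in
/-- **`K₃` on the support of a `{o, a₂}`-pocket split is a side kernel.** -/
theorem K3_eq_sideQ {WP WF : Set V} {F : Finset E} {z : Config E}
    (h : SplitQ ends o a₁ a₂ a₃ b WP WF F z) {x y w : Config E}
    (hx : ∀ e, e ∉ F → x e = z e) (hy : ∀ e, e ∉ F → y e = z e) (hw : ∀ e, e ∉ F → w e = z e) :
    (K3 ends o a₁ a₂ a₃ b x y w : R) =
      sideKernel (sideF ends WP F) (sideF ends WF F) z (sideΦQ ends o a₁ a₂ a₃ b WP WF) x y w := by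
  rw [K3_eq_KB, st_eq_harrisStQ h (le_zF hx), st_eq_harrisStQ h (le_zF hy),
    st_eq_harrisStQ h (le_zF hw)]
  unfold sideKernel sideΦQ
  rw [PocketAB.oStP_restr (o := b) (a₃ := o) (b := a₂) WP hx,
    PocketAB.oStP_restr (o := b) (a₃ := o) (b := a₂) WP hy,
    PocketAB.oStP_restr (o := b) (a₃ := o) (b := a₂) WP hw,
    bSt_restr (b := o) WF hx, bSt_restr (b := o) WF hy, bSt_restr (b := o) WF hw]

omit [Fintype E] [DecidableEq E] [LinearOrder R] [IsStrictOrderedRing R] in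
/-- The doubly symmetrised side kernel is `dsymQ` on the side states. -/
lemma symB_symA_sideΦQ (WP WF : Set V) (xa ya wa xb yb wb : Config E) :
    symB (symA (sideΦQ ends o a₁ a₂ a₃ b WP WF)) xa ya wa xb yb wb =
      ((dsymQ (PocketAB.oStP ends b o a₂ WP xa) (PocketAB.oStP ends b o a₂ WP ya)
        (PocketAB.oStP ends b o a₂ WP wa) (bSt ends a₁ a₂ a₃ o WF xb) (bSt ends a₁ a₂ a₃ o WF yb)
        (bSt ends a₁ a₂ a₃ o WF wb) : ℤ) : R) := by
  unfold symB symA sideΦQ dsymQ psiQ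
  push_cast
  ring

omit [Fintype E] [DecidableEq E] in
/-- **The doubly symmetrised side kernel dominates its certified part.** -/
lemma certΦQ_le_symB_symA (WP WF : Set V) (xa ya wa xb yb wb : Config E) :
    certΦQ ends o a₁ a₂ a₃ b WP WF xa ya wa xb yb wb ≤
      symB (symA (sideΦQ (R := R) ends o a₁ a₂ a₃ b WP WF)) xa ya wa xb yb wb := by
  rw [symB_symA_sideΦQ]
  unfold certΦQ
  have hsort := dsymQ_sort3B (PocketAB.oStP ends b o a₂ WP xa) (PocketAB.oStP ends b o a₂ WP ya)
    (PocketAB.oStP ends b o a₂ WP wa) (bSt ends a₁ a₂ a₃ o WF xb) (bSt ends a₁ a₂ a₃ o WF yb)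
    (bSt ends a₁ a₂ a₃ o WF wb)
  rw [hsort]
  exact_mod_cast dsymQ_ge_combQ_sorted _ _ _ _ _ _ (PocketAB.validO_oStP WP xa)
    (PocketAB.validO_oStP WP ya) (PocketAB.validO_oStP WP wa)
    (sort3B_mem _ _ _ (validB_bSt WF xb) (validB_bSt WF yb) (validB_bSt WF wb))

/-! ## The slacks on the pocket side -/

/-- The four events are monotone. -/
lemma upQ_mono (i : Fin 4) (s s' : OSt) (hs : s ≤ s') (h : upQ i s = true) :
    upQ i s' = true := by
  obtain ⟨h1, h2, h3⟩ := hs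
  have e1 : s.1 = true → s'.1 = true := fun hh => by rw [hh] at h1; exact Bool.eq_true_of_true_le h1
  have e2 : s.2.1 = true → s'.2.1 = true := fun hh => by
    rw [hh] at h2; exact Bool.eq_true_of_true_le h2
  have e3 : s.2.2 = true → s'.2.2 = true := fun hh => by
    rw [hh] at h3; exact Bool.eq_true_of_true_le h3
  fin_cases i <;> simp only [upQ, Bool.or_eq_true] at h ⊢
  · exact e3 h
  · exact h.elim (fun hh => Or.inl (e3 hh)) (fun hh => Or.inr (e1 hh))
  · exact e2 h
  · exact h.elim (fun hh => Or.inl (e1 hh)) (fun hh => Or.inr (e2 hh))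

omit [Fintype E] [DecidableEq E] [LinearOrder R] [IsStrictOrderedRing R] in
/-- The slack kernel, cast to `R`, in the form of `typedCount_slack_nonneg`. -/
lemma slackQ_cast (f : Option OSt) (a c : Fin 4) (x y w : OSt) :
    ((slackQ f a c x y w : ℤ) : R) =
      ((specQ f w : ℤ) : R) * ((if upQ a x = true then (1 : R) else 0) *
        ((if upQ c x = true then (1 : R) else 0) - (if upQ c y = true then (1 : R) else 0))) := by
  unfold slackQ bz
  push_cast
  rfl

/-- **Every six-fold symmetrised slack has nonnegative typed count on the pocket side.** -/
theorem typedCount_genQ_nonneg (WP : Set V) (A : Finset E) (z : Config E) (τ : E → ℕ)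
    (hτ : ∀ e ∈ A, τ e = 1 ∨ τ e = 2) (g : GenLabel) :
    0 ≤ typedCount A z τ (fun x y w =>
      ((genQ g.1 g.2.1 g.2.2 (PocketAB.oStP ends b o a₂ WP x) (PocketAB.oStP ends b o a₂ WP y)
        (PocketAB.oStP ends b o a₂ WP w) : ℤ) : R)) := by
  have hspec : ∀ s : OSt, (0 : R) ≤ ((specQ g.1 s : ℤ) : R) := by
    intro s
    rcases g.1 with _ | t
    · simp [specQ]
    · simp only [specQ]
      split_ifs <;> simp
  have hK := TypedHarris.typedCount_slack_nonneg (R := R) A z τ hτ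
    (PocketAB.oStP ends b o a₂ WP) (oStP_monotone (o := b) (a₁ := o) (b := a₂) WP)
    (upQ g.2.1) (upQ g.2.2) (upQ_mono g.2.1) (upQ_mono g.2.2)
    (fun s => ((specQ g.1 s : ℤ) : R)) hspec
  have h6 := TypedHarris.typedCount_sym6_nonneg (R := R) A z τ hτ _ hK
  refine le_of_le_of_eq h6 (typedCount_congr' _ _ _ _ _ fun x y w => ?_)
  unfold genQ
  push_cast
  simp only [slackQ_cast]

/-! ## The theorem -/

/-- **ROW 2′TRI ON THE `{o, a₂}`-POCKET CLASS**: on a `{o, a₂}`-pocket split — the doors `o, a₂`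
separate `b` from `a₁` and `a₃` — every typed base of `K₃` is nonnegative, for every pinning `z`
and every type map with values in `{1, 2}` on `F`. -/
theorem typedCount_nonneg_of_splitQ {WP WF : Set V} (F : Finset E) (z : Config E) (τ : E → ℕ)
    (hτ : ∀ e ∈ F, τ e = 1 ∨ τ e = 2) (h : SplitQ ends o a₁ a₂ a₃ b WP WF F z) :
    0 ≤ typedCount F z τ (K3 ends o a₁ a₂ a₃ b : Config E → Config E → Config E → R) := by
  set A := sideF ends WP F with hA
  set B := sideF ends WF F with hB
  have hAF : A ⊆ F := Finset.filter_subset _ _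
  have hBF : B ⊆ F := Finset.filter_subset _ _
  have hAB : Disjoint A B := by
    rw [Finset.disjoint_left]
    intro e heA heB
    simp only [hA, hB, sideF, Finset.mem_filter] at heA heB
    exact h.noloop e heA.1 ⟨heA.2, heB.2⟩
  have hF : A ∪ B = F := by
    apply Finset.Subset.antisymm (Finset.union_subset hAF hBF)
    intro e he
    have hz : zF F z e = true := by simp [zF, he]
    rcases h.split e hz with hw | hw
    · exact Finset.mem_union_left _ (Finset.mem_filter.2 ⟨he, hw⟩)
    · exact Finset.mem_union_right _ (Finset.mem_filter.2 ⟨he, hw⟩)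
  have hτA : ∀ e ∈ A, τ e = 1 ∨ τ e = 2 := fun e he => hτ e (hAF he)
  have hker : typedCount F z τ (K3 ends o a₁ a₂ a₃ b : Config E → Config E → Config E → R) =
      typedCount F z τ (sideKernel A B z (sideΦQ ends o a₁ a₂ a₃ b WP WF)) := by
    refine typedCount_congr_on_support F z τ fun x y w hc _ => ?_
    exact K3_eq_sideQ h (fun e he => (hc e he).1) (fun e he => (hc e he).2.1)
      (fun e he => (hc e he).2.2)
  rw [hker]
  have h36 := thirtysix_mul_typedCount_side F hAF hBF hAB z τ
    (sideΦQ (R := R) ends o a₁ a₂ a₃ b WP WF)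
  set Φs := symB (symA (sideΦQ (R := R) ends o a₁ a₂ a₃ b WP WF)) with hΦs
  set Φc := certΦQ (R := R) ends o a₁ a₂ a₃ b WP WF with hΦc
  have hsplit : typedCount F z τ (sideKernel A B z Φs) =
      typedCount F z τ (sideKernel A B z Φc) +
        typedCount F z τ (sideKernel A B z fun xa ya wa xb yb wb =>
          Φs xa ya wa xb yb wb - Φc xa ya wa xb yb wb) := by
    rw [← typedCount_add']
    refine typedCount_congr' _ _ _ _ _ fun x y w => ?_
    simp only [sideKernel]
    ring
  have hrem : 0 ≤ typedCount F z τ (sideKernel A B z fun xa ya wa xb yb wb =>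
      Φs xa ya wa xb yb wb - Φc xa ya wa xb yb wb) := by
    refine typedCount_nonneg_of_nonneg _ _ _ fun x y w => ?_
    simp only [sideKernel]
    exact sub_nonneg.2 (certΦQ_le_symB_symA WP WF _ _ _ _ _ _)
  have hcert : 0 ≤ typedCount F z τ (sideKernel A B z Φc) := by
    have hsum : sideKernel A B z Φc = fun x y w => ∑ g : GenLabel,
        (((genQ g.1 g.2.1 g.2.2 (PocketAB.oStP ends b o a₂ WP (restr A z x))
            (PocketAB.oStP ends b o a₂ WP (restr A z y))
            (PocketAB.oStP ends b o a₂ WP (restr A z w)) : ℤ) : R) *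
          ((weightQ g (sortedF ends o a₁ a₂ a₃ WF (restr B z x) (restr B z y) (restr B z w)).1
            (sortedF ends o a₁ a₂ a₃ WF (restr B z x) (restr B z y) (restr B z w)).2.1
            (sortedF ends o a₁ a₂ a₃ WF (restr B z x) (restr B z y) (restr B z w)).2.2 : ℕ) : R)) := by
      funext x y w
      simp only [sideKernel, hΦc, certΦQ, combQ_eq_gensum]
      push_cast
      refine Finset.sum_congr rfl fun g _ => ?_
      ring
    rw [hsum, typedCount_finsum]
    refine Finset.sum_nonneg fun g _ => ?_
    have hfac := typedCount_mul_of_disjoint (R := R) A B hAB z τ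
      (fun x y w => ((genQ g.1 g.2.1 g.2.2 (PocketAB.oStP ends b o a₂ WP x)
        (PocketAB.oStP ends b o a₂ WP y) (PocketAB.oStP ends b o a₂ WP w) : ℤ) : R))
      (fun x y w => ((weightQ g (sortedF ends o a₁ a₂ a₃ WF x y w).1
        (sortedF ends o a₁ a₂ a₃ WF x y w).2.1 (sortedF ends o a₁ a₂ a₃ WF x y w).2.2 : ℕ) : R))
    rw [hF] at hfac
    rw [hfac]
    refine mul_nonneg (typedCount_genQ_nonneg WP A z τ hτA g) ?_
    exact typedCount_nonneg_of_nonneg _ _ _ fun x y w => Nat.cast_nonneg _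
  have h36' : (0 : R) ≤ 36 * typedCount F z τ (sideKernel A B z (sideΦQ ends o a₁ a₂ a₃ b WP WF)) := by
    rw [h36, hsplit]
    exact add_nonneg hcert hrem
  exact nonneg_of_mul_nonneg_right (by simpa [mul_comm] using h36') (by norm_num : (0 : R) < 36)

variable (ends o a₁ a₂ a₃ b)

/-- **The class of the typed graph `(V, F)`**: the doors `o, a₂` separate `b` from `{a₁, a₃}`
(`b`'s pocket hangs on the mark `o` and the root `a₂`). -/
def HasPocketOA2 (F : Finset E) : Prop :=
  ∃ WP WF : Set V, SplitQ ends o a₁ a₂ a₃ b WP WF F (fun _ => false)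

/-- **Row 2′TRI on `HasPocketOA2` at `z ≡ false`** — a nonnegativity conjunct for the residual
domain (types in `{1, 2}`). -/
theorem typedCount_nonneg_of_hasPocketOA2 (F : Finset E) (τ : E → ℕ)
    (hτ : ∀ e ∈ F, τ e = 1 ∨ τ e = 2) (h : HasPocketOA2 ends o a₁ a₂ a₃ b F) :
    0 ≤ typedCount F (fun _ => false) τ
      (K3 ends o a₁ a₂ a₃ b : Config E → Config E → Config E → R) := by
  obtain ⟨WP, WF, hs⟩ := h
  exact typedCount_nonneg_of_splitQ F _ τ hτ hs

/-- **The mirror class** (the doors `o, a₁` separate `b` from `{a₂, a₃}`), by the root symmetry. -/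
theorem typedCount_nonneg_of_hasPocketOA2_mirror (F : Finset E) (τ : E → ℕ)
    (hτ : ∀ e ∈ F, τ e = 1 ∨ τ e = 2) (h : HasPocketOA2 ends o a₂ a₁ a₃ b F) :
    0 ≤ typedCount F (fun _ => false) τ
      (K3 ends o a₁ a₂ a₃ b : Config E → Config E → Config E → R) := by
  rw [← SwapRoots.typedCount_swap_roots]
  exact typedCount_nonneg_of_hasPocketOA2 ends o a₂ a₁ a₃ b F τ hτ h

end Main

end PocketOA2

end CovForm

end Summit.Ventures.PercRepro2
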